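import Mathlib.Analysis.Fourier.FiniteAbelian.PontryaginDuality
import Literature.Computability.AlgebraicComplexity.GroupTheoreticMatMul
import Literature.Computability.AlgebraicComplexity.AsymptoticSumInequality
import HarnessLib

/-!
# Proof of CKSU 2005, Thm. 5.5 (abelian case): `∑ᵢ (|Aᵢ||Bᵢ||Cᵢ|)^{ω/3} ≤ |H|` for STPP families

Topic `Literature/Computability/AlgebraicComplexity`; sibling of `GroupTheoreticMatMul.lean`, which
vendors the named fact `CohnKleinbergSzegedyUmans2005_5_5_abelian` (Cohn–Kleinberg–Szegedy–Umans
2005, Thm. 5.5, abelian case; Blasiak et al. 2017, (1.1)). This file DISCHARGES it: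
`CohnKleinbergSzegedyUmans2005_5_5_abelian_holds`.

## Proof (as printed: CKSU 2005, p. 9, "By Schönhage's asymptotic sum inequality ((15.11) in [BCS])"
applied to the reduction Thm. 5.3)

1. `(z, x, y) ↦ [x + y = z]` is the structure tensor of the group algebra `R[H]` of an additive
   abelian group (written inline); for `H` finite, `R(ℂ[H]) ≤ |H|` by the character decomposition
   `[x + y = z] = |H|⁻¹ ∑_ψ ψ(x)ψ(y)ψ(−z)` (`tensorRank_addGroupAlgTensor_le`; Mathlib
   `AddChar.sum_apply_eq_ite`, `AddChar.card_eq`) — CKSU §1.1: `ℂ[G] ≅ ⊕ ℂ^{dᵢ×dᵢ}`, all `dᵢ = 1`.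
2. CKSU Thm. 5.3 (the reduction), tensor form: under the STPP, `⊕ᵢ ⟨|Aᵢ|,|Bᵢ|,|Cᵢ|⟩`
   (`matMulDirectSum`) is the restriction of the structure tensor along
   `X^{(i)}_{(s',t)} ↦ s' − t`, `Y^{(j)}_{(t',u)} ↦ t' − u`, `Z^{(k)}_{(s,u')} ↦ s − u'`
   (`matMulDirectSum_eq_precomp_of_isSTPP`), so `R(⊕ᵢ ⟨|Aᵢ|,|Bᵢ|,|Cᵢ|⟩) ≤ |H|`
   (`tensorRank_matMulDirectSum_le_card_of_isSTPP`).
3. The rank version of Schönhage's asymptotic sum inequality (`asymptoticSumInequality_rank`,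
   `AsymptoticSumInequality.lean`; Bläser 2013 Thm. 7.5, BCS (15.11)).

## References

* H. Cohn, R. Kleinberg, B. Szegedy, C. Umans, *Group-theoretic algorithms for matrix
  multiplication*, FOCS 2005, arXiv:math/0511460 (held: `paper:arxiv-math_0511460`, read pp. 8–9):
  Def. 5.1, Thm. 5.3 and its proof, Thm. 5.5 (arXiv environment numbers 27, 29, 31).
  [CohnKleinbergSzegedyUmans2005]
* M. Bläser, *Fast Matrix Multiplication*, ToC Graduate Surveys 5 (2013), Thm. 7.5. [Blaser2013]
-/

noncomputable section

open scoped BigOperators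

namespace Literature.Computability.AlgebraicComplexity

/-! ## The structure tensor of the group algebra of a finite abelian group -/

section GroupAlgebra

variable (H : Type*) [AddCommGroup H] [DecidableEq H]

/-- **`R(ℂ[H]) ≤ |H|` for a finite abelian group `H`.** The structure tensor of the group algebra
`ℂ[H]` of an additive abelian group, in the coordinate format `ι → κ → μ → ℂ` of
`MatrixMultiplicationExponent` (first index: the output coordinate `z`, then the inputs `x`, `y`),
is `(z, x, y) ↦ [x + y = z]` — the tensor of `(∑ aₓ x, ∑ b_y y) ↦ ∑_z (∑_{x+y=z} aₓ b_y) z`. The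
`|H|` characters `ψ` of `H` diagonalise it: `[x + y = z] = |H|⁻¹ ∑_ψ ψ(x) ψ(y) ψ(−z)`
(orthogonality), a decomposition into `|Ĥ| = |H|` triads (CKSU 2005, §1.1: `ℂ[G] ≅ ⊕ ℂ^{dᵢ×dᵢ}`,
all `dᵢ = 1` for abelian `G`; Thm. 5.5: "in which case `∑ d_k^ω = |H|`"). Mathlib:
`AddChar.sum_apply_eq_ite`, `AddChar.card_eq`. [cite: CohnKleinbergSzegedyUmans2005, §1.1 and Thm. 5.5] -/
theorem tensorRank_addGroupAlgTensor_le [Fintype H] :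
    tensorRank (fun z x y : H => if x + y = z then (1 : ℂ) else 0) ≤ Fintype.card H := by
  rw [← AddChar.card_eq (α := H)]
  refine tensorRank_le_card_of_eq_sum
    (fun ψ z => ψ (-z) / (Fintype.card H : ℂ)) (fun ψ x => ψ x) (fun ψ y => ψ y) ?_
  funext z x y
  rw [Finset.sum_apply, Finset.sum_apply, Finset.sum_apply]
  simp only [triad_apply]
  have key : ∀ ψ : AddChar H ℂ,
      ψ (-z) / (Fintype.card H : ℂ) * ψ x * ψ y = ψ (x + y - z) / (Fintype.card H : ℂ) := by
    intro ψ
    rw [sub_eq_add_neg, AddChar.map_add_eq_mul, AddChar.map_add_eq_mul]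
    ring
  simp_rw [key]
  rw [← Finset.sum_div, AddChar.sum_apply_eq_ite]
  by_cases hxy : x + y = z
  · rw [if_pos hxy, if_pos (sub_eq_zero.2 hxy), div_self (Nat.cast_ne_zero.2 Fintype.card_ne_zero)]
  · rw [if_neg hxy, if_neg (fun h => hxy (sub_eq_zero.1 h)), zero_div]

end GroupAlgebra

/-! ## STPP: independent matrix products inside one group algebra product (CKSU Thm. 5.3) -/

section STPP

variable {H : Type*} [AddCommGroup H] [DecidableEq H] (R : Type*) [CommSemiring R] {N : ℕ}

/-- **CKSU 2005, Thm. 5.3 (reduction), tensor form.** If `(Aᵢ, Bᵢ, Cᵢ)_{i<N}` satisfy the STPP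
then `⊕ᵢ ⟨|Aᵢ|, |Bᵢ|, |Cᵢ|⟩` is the restriction of the structure tensor `[x + y = z]` of `R[H]`
along the index maps `X^{(i)}_{(s',t)} ↦ s' − t`, `Y^{(j)}_{(t',u)} ↦ t' − u`,
`Z^{(k)}_{(s,u')} ↦ s − u'` (additive form of "`(s⁻¹t)(t'⁻¹u) = s'⁻¹u'` … iff `i = j = k` and
`s = s'`, `t = t'`, `u = u'`", CKSU 2005, proof of Thm. 5.3; the blocks `Fin |Aᵢ|` are identified
with `Aᵢ` by `Finset.equivFin`). [cite: CohnKleinbergSzegedyUmans2005, Thm. 5.3] -/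
theorem matMulDirectSum_eq_precomp_of_isSTPP (A B C : Fin N → Finset H) (hS : IsSTPP A B C) :
    matMulDirectSum R (fun i => (A i).card) (fun i => (B i).card) (fun i => (C i).card) =
      fun a b c => (fun z x y : H => if x + y = z then (1 : R) else 0)
        (((A a.1).equivFin.symm a.2.1 : H) - ((C a.1).equivFin.symm a.2.2 : H))
        (((A b.1).equivFin.symm b.2.1 : H) - ((B b.1).equivFin.symm b.2.2 : H))
        (((B c.1).equivFin.symm c.2.1 : H) - ((C c.1).equivFin.symm c.2.2 : H)) := by
  funext a b c
  obtain ⟨i₁, κ, ν⟩ := a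
  obtain ⟨i₂, κ', μ⟩ := b
  obtain ⟨i₃, μ', ν'⟩ := c
  simp only [matMulDirectSum]
  refine ite_congr_prop ?_
  constructor
  · rintro ⟨rfl, rfl, h1, h2, h3⟩
    obtain rfl : κ = κ' := Fin.ext h1
    obtain rfl : μ = μ' := Fin.ext h2
    obtain rfl : ν = ν' := Fin.ext h3
    abel
  · intro heq
    have h0 : (((A i₂).equivFin.symm κ' : H) - ((A i₁).equivFin.symm κ : H)) +
        (((B i₃).equivFin.symm μ' : H) - ((B i₂).equivFin.symm μ : H)) +
        (((C i₁).equivFin.symm ν : H) - ((C i₃).equivFin.symm ν' : H)) = 0 := by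
      rw [← sub_eq_zero] at heq
      rw [← heq]
      abel
    obtain ⟨h12, h23, hs, ht, hu⟩ := hS i₂ i₃ i₁ _ ((A i₁).equivFin.symm κ).2
      _ ((A i₂).equivFin.symm κ').2 _ ((B i₂).equivFin.symm μ).2 _ ((B i₃).equivFin.symm μ').2
      _ ((C i₃).equivFin.symm ν').2 _ ((C i₁).equivFin.symm ν).2 h0
    subst h12
    subst h23
    refine ⟨rfl, rfl, ?_, ?_, ?_⟩
    · rw [(A i₂).equivFin.symm.injective (Subtype.ext hs)]
    · rw [(B i₂).equivFin.symm.injective (Subtype.ext ht)]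
    · rw [(C i₂).equivFin.symm.injective (Subtype.ext hu)]

/-- Hence **`R(⊕ᵢ ⟨|Aᵢ|, |Bᵢ|, |Cᵢ|⟩) ≤ R(ℂ[H]) ≤ |H|`** for an STPP family in a finite abelian
group (CKSU 2005, Thm. 5.3, with `∑ d_k^ω = |H|`). [cite: CohnKleinbergSzegedyUmans2005, Thm. 5.3] -/
theorem tensorRank_matMulDirectSum_le_card_of_isSTPP [Fintype H] (A B C : Fin N → Finset H)
    (hS : IsSTPP A B C) :
    tensorRank (matMulDirectSum ℂ (fun i => (A i).card) (fun i => (B i).card)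
      (fun i => (C i).card)) ≤ Fintype.card H := by
  rw [matMulDirectSum_eq_precomp_of_isSTPP ℂ A B C hS]
  exact (tensorRank_precomp_le _ _ _ _).trans (tensorRank_addGroupAlgTensor_le H)

end STPP

/-! ## The discharge -/

/-- DISCHARGE of `CohnKleinbergSzegedyUmans2005_5_5_abelian` (`GroupTheoreticMatMul.lean`) —
**Cohn–Kleinberg–Szegedy–Umans 2005, Thm. 5.5, abelian case**: for every finite abelian group `H`
and every STPP family `(Aᵢ, Bᵢ, Cᵢ)_{i<N}` in `H`, `∑ᵢ (|Aᵢ| |Bᵢ| |Cᵢ|)^{ω(ℂ)/3} ≤ |H|`.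
Proof as printed ("By Schönhage's asymptotic sum inequality ((15.11) in [BCS])" applied to the
reduction of Thm. 5.3): `R(⊕ᵢ ⟨|Aᵢ|,|Bᵢ|,|Cᵢ|⟩) ≤ R(ℂ[H]) = |H|`
(`tensorRank_matMulDirectSum_le_card_of_isSTPP`, characters of `H`) and the rank version of the
asymptotic sum inequality (`asymptoticSumInequality_rank`, Bläser 2013 Thm. 7.5).
[cite: CohnKleinbergSzegedyUmans2005, Thm. 5.5] -/
theorem CohnKleinbergSzegedyUmans2005_5_5_abelian_holds :
    CohnKleinbergSzegedyUmans2005_5_5_abelian := by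
  intro H _ _ N A B C hS
  classical
  exact asymptoticSumInequality_rank ℂ (fun i => (A i).card) (fun i => (B i).card)
    (fun i => (C i).card) (tensorRank_matMulDirectSum_le_card_of_isSTPP A B C hS)

end Literature.Computability.AlgebraicComplexity

end
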